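import Literature.Computability.AlgebraicComplexity.LaserDegenerationBound
import HarnessLib

/-!
# VXXZ 2024, `ω ≤ 2.371552`: the square assembly at `q = 5` (method layer in HYPOTHESIS form)

Topic `Literature/Computability/AlgebraicComplexity`.  Proof-side companion of the record
`ω(ℂ) ≤ 2.371552` (Vassilevska Williams–Xu–Xu–Zhou, *New bounds for matrix multiplication: from alpha
to omega*, SODA 2024, arXiv:2307.07970) — row `κ = 1` of the named fact `vxxz2024_omegaRect_table`
(`RectangularExponent.lean`); until 2026-08-15 also the separate named fact `vxxz2024_omega_le`, since
merged back into the table facts (D-0026 split review: a row of the table, not a separately proved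
result), so the theorem below concludes `omega ℂ ≤ 2.371552` inline.

The printed proof (§4.1 "Algorithm Framework"; §8, first paragraph and the displayed optimisation
problem "minimize `ω'` subject to …", `κ = 1`, `q = 5`, `l* = 3`) has two layers:

* the CLASSICAL layer, all PROVED in the tree — Schönhage's asymptotic sum inequality in
  asymptotic-rank form (VXXZ Thms. 3.1/3.2: `SchoenhageTauDischarge.lean`, `SchonhageRectangular.lean`),
  `R̃(CW_q) ≤ q + 2` (VXXZ §3.6: `BigCoppersmithWinograd*.lean`, `BorderRankKronecker.lean`,
  `AsymptoticRankBorderRank.lean`), monotonicity of `R̃` under degeneration (VXXZ §3.3: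
  `UniversalMethodBarrierAsymptoticRank.asymptoticRank_le_of_polyDegeneratesTo`), glued in
  `LaserDegenerationBound.omega_le_of_forall_polyDegeneratesTo`; and
* the METHOD layer — the degenerations the paper's algorithm produces: global stage (Thm. 5.3),
  constituent stages (Thms. 6.1, 6.3), fixing holes (Cor. 4.2 / Thm. 7.2), with the counts certified
  by the numerical optimisation of §8 ("All bounds are obtained by analyzing the fourth power of the
  CW tensor with `q = 5`"; 6759 parameters per row, SNOPT/MATLAB, published at osf.io/7wgh2).  In the
  finite form the classical layer consumes: for every `δ > 0` some `⟨M⟩ ⊗ CW_5^{⊗N}` degenerates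
  (over `ℂ[λ]`, §3.3) into `⟨t⟩ ⊗ ⟨m, m, m⟩`, `t ≥ 1`, `m ≥ 2`, with `M · 7^N ≤ t · m^{2.371552+δ}`
  (from the printed limits `lim_{ε→0} lim_{n→∞}` of `numgrow^{1/n}`, `a^{1/n}`, `b^{1/n}`, `c^{1/n}`
  and the constraint `lim numgrow^{1/n} · min{a,b,c}^{ω'/n} ≥ (q+2)^{2^{l*-1}}`, taking
  `m = min{a, b, c}` — a restriction of `⟨a, b, c⟩` — `ε` small and `n` large; `M = 2^{o(n)}` and the
  `o(n)` losses are absorbed by `m^δ` since `m` grows exponentially in `n`).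

This file PROVES the passage from the method layer, taken as an explicit hypothesis, to
`vxxz2024_omega_le` (`vxxz2024_omega_le_of_forall_polyDegeneratesTo`).  The method layer is NOT a
named fact of the tree: from p23738 (2026-08-15) to the D-0026 split review of the same day it was
vendored here as `def vxxz2024_algorithm_output : Prop`, a decomposition child of
`vxxz2024_omega_le`; the review MERGED it back, because (i) it is the parent minus the proved
classical layer — a slice of the parent's proof, not a separately printed theorem with its own
locator (it bundles Thms. 5.3, 6.1, 6.3, 7.2 AND the §8 numerics); (ii) its discharge is the whole
asymmetric-hashing laser method of §4–§7 as a parametric theorem plus an exact feasible point of the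
§8 program — a theory, not an inline proof (triaged XL by its proving seat); (iii) the tree already
carries the identical trust base ONCE, table-indexed and in hypothesis form:
`CW5DegenerationCertificate vxxz2024Table` / `… vxxz2024TableCertified`
(`RectangularExponentLaserCertificate.lean`, `RectangularExponentCert*.lean`), whose `κ = 1` row
restricted to squares is exactly this hypothesis
(`RectangularExponentCertReduction.forall_polyDegeneratesTo_square_of_cw5Certificate`), with the
proved consequences `vxxz2024_omegaRect_table_of_cw5Certificate`, `vxxz2024_omega_le_of_cw5Certificate`,
`vxxz2024_omega_le_of_cw5Certificate_square`; layer (C) of that certificate (the numerics) has an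
exact interval-arithmetic re-certification on record (ledger item `wi-04482`, evidence of
2026-08-15), so what separates `vxxz2024_omega_le` from a theorem is layer (T) alone — the
formalisation of Thms. 5.3/6.1/6.3 and Cor. 4.2 as "program (§8) feasible at `(κ, ω')` ⇒ the
degenerations".  Stated over `ℂ` (the paper works over an arbitrary field).

## References

* V. Vassilevska Williams, Y. Xu, Z. Xu, R. Zhou, *New bounds for matrix multiplication: from alpha
  to omega*, SODA 2024, arXiv:2307.07970: abstract, §1.1 (Table 1), §3.3, §4.1, Cor. 4.2, Thm. 5.3,
  Thm. 6.1, Thm. 6.3, Thm. 7.2, §8 (Numerical Result: the optimisation problem, "fourth power …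
  `q = 5`", osf.io/7wgh2). [VassilevskaWilliamsXuXuZhou2024]
-/

noncomputable section

open Literature.Barriers.MatrixMultiplication (bigCwTensor PolyDegeneratesTo)

namespace Literature.Computability.AlgebraicComplexity

/-- **The assembly "method layer → `ω(ℂ) ≤ 2.371552`" of Vassilevska Williams–Xu–Xu–Zhou 2024,
square case** (`κ = 1`, `q = 5`, fourth power): IF for every `δ > 0` there are `t ≥ 1`, `m ≥ 2`,
`M`, `N` such that `M` independent copies of `CW_5^{⊗N}` degenerate over `ℂ[λ]` into `t` independent
copies of `⟨m, m, m⟩` with `M · 7^N ≤ t · m^{2.371552 + δ}` — the output of the algorithm of §4–§7 at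
the parameters of §8, in the finite form of the module docstring; an explicit hypothesis, NOT a
named fact (obtainable from a `CW_5` degeneration certificate:
`forall_polyDegeneratesTo_square_of_cw5Certificate`) — THEN `ω(ℂ) ≤ 2.371552` (stated inline: the
former named fact `vxxz2024_omega_le` was merged back into the table facts of
`RectangularExponent.lean` by the D-0026 split review of 2026-08-15).  The classical
layer (asymptotic sum inequality, `R̃(CW_5) ≤ 7`, monotonicity of `R̃` under degeneration) is the
proved `LaserDegenerationBound.omega_le_of_forall_polyDegeneratesTo`, here at `q = 5`, `(5:ℝ)+2 = 7`.
[cite: VassilevskaWilliamsXuXuZhou2024, §8 (with §4.1, Thms. 5.3, 6.1, 6.3, 7.2)] -/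
theorem vxxz2024_omega_le_of_forall_polyDegeneratesTo
    (h : ∀ δ : ℝ, 0 < δ → ∃ t m M N : ℕ, 1 ≤ t ∧ 2 ≤ m ∧
      PolyDegeneratesTo (kroneckerTensor (unitTensor ℂ M) (kroneckerPow (bigCwTensor ℂ 5) N))
        (kroneckerTensor (unitTensor ℂ t) (matMulTensor ℂ m m m)) ∧
      (M : ℝ) * 7 ^ N ≤ (t : ℝ) * (m : ℝ) ^ ((2.371552 : ℝ) + δ)) :
    omega ℂ ≤ 2.371552 := by
  refine omega_le_of_forall_polyDegeneratesTo ℂ (q := 5) fun δ hδ => ?_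
  obtain ⟨t, m, M, N, ht, hm, hdeg, hcount⟩ := h δ hδ
  refine ⟨t, m, M, N, ht, hm, hdeg, ?_⟩
  have h7 : ((5 : ℕ) : ℝ) + 2 = 7 := by norm_num
  rw [h7]
  exact hcount

end Literature.Computability.AlgebraicComplexity

end
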